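import Literature.Analysis.ValidatedNumerics.IntervalLogArctan
import Literature.NumberTheory.Transcendental.ZudilinPhaseBounds
import HarnessLib

/-!
# Interval evaluators for Zudilin's phase `Φ`, `Φ'`, `Φ''` and the saddle polynomial

Topic `Literature/NumberTheory/Transcendental`; the numerical companion of `ZudilinPhase.lean`
announced there. It DEFINES

* `Zudilin2004.ddphase` — `Φ''(κ) = 3/κ − 3/(κ−27) + 3/(κ+64) − 3/(κ+37) − Σ_u (1/(κ+25+u) −
  1/(κ+12−u))`, with `Zudilin2004.hasDerivAt_dphase` (`Φ'' = (Φ')'` on the upper half-plane);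
* `Zudilin2004.saddleQ` — the polynomial function
  `Q(κ) = κ³(κ+64)³∏_u(κ+12−u) − (κ−27)³(κ+37)³∏_u(κ+25+u)` whose zeros in the upper half-plane
  with `|Φ'| < 2π` are exactly the saddle points (`Zudilin2004.dphase_eq_zero_of_saddleQ`);
* kernel-reducible interval evaluators in the multi-precision engine
  `Literature.Analysis.ValidatedNumerics.NumericsMP` (`MultiPrecisionInterval.lean`,
  `IntervalLogArctan.lean`): `SaddleNum.LBox` (`(κ+a) log(κ+a) − (κ+a)`), `blockIntBox`,
  `denomSum`, `c1Box`, `psiRBox`, `phaseBox`, `dlogSum`, `dphaseBox`, `ddSum`, `ddphaseBox`,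
  `qProdA`/`qProdB`/`saddleQBox`, each with its inclusion theorem (`SaddleNum.mem_phaseBox`, …);
* the data of the certificates: the approximate saddle point `SaddleNum.kApprox = κ̃`
  (`SaddleNum.pRe`, `SaddleNum.pIm` at scale `2^100`), the boxes `SaddleNum.boxB` (`κ̃ ± 2^{−60}`),
  `SaddleNum.lineBox` (vertical boxes on the line `re κ = re κ̃`), `SaddleNum.sBox ⊇ saddleBox`,
  `SaddleNum.piBox`, and the Boolean scan `SaddleNum.checkConcave` of `re Φ'' > 0` up the line
  with its soundness theorem `SaddleNum.re_ddphase_pos_of_checkConcave`.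

No named fact is introduced; the certificates themselves (kernel evaluations by `decide +kernel`,
about 9 s for `Φ'` on a box, 20 s for two values of `Φ`, under a minute for the scan) are in
`ZudilinSaddleCertificates.lean`.

## References

* [Zudilin2004] W. Zudilin, *Arithmetic of linear forms involving odd zeta values*, J. Théor.
  Nombres Bordeaux 16 (2004), §8, Lemma 20 and the proof of Thm. 3 (`τ₀`, `C₀`, `C₂`).
* R. E. Moore, *Interval Analysis* (1966), Ch. 3 (inclusion property). [folklore]
-/

noncomputable section

open Complex Finset
open Literature.Analysis.ValidatedNumerics.NumericsMP

namespace Literature.NumberTheory.Transcendental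

namespace Zudilin2004

/-! ### `Φ''` -/

/-- **`Φ''`**: `ddphase κ = 3/κ − 3/(κ−27) + 3/(κ+64) − 3/(κ+37) − Σ_{u=1}^{10} (1/(κ+25+u) − 1/(κ+12−u))`.
[cite: Zudilin2004, §8 Lemma 20] -/
def ddphase (κ : ℂ) : ℂ :=
  3 / κ - 3 / (κ - 27) + 3 / (κ + 64) - 3 / (κ + 37) -
    ∑ u ∈ Icc (1 : ℕ) 10, (1 / (κ + 25 + (u : ℂ)) - 1 / (κ + 12 - (u : ℂ)))

/-- `(Φ')' = Φ''` on the open upper half-plane. [cite: Zudilin2004, §8 Lemma 20] -/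
theorem hasDerivAt_dphase {κ : ℂ} (hκ : 0 < κ.im) : HasDerivAt dphase (ddphase κ) κ := by
  have hl : ∀ a : ℝ, HasDerivAt (fun w : ℂ ↦ log (w + a)) (1 / (κ + a)) κ := fun a ↦
    ((hasDerivAt_id κ).add_const (a : ℂ)).clog (add_real_mem_slitPlane hκ a)
  have h0 : HasDerivAt (fun w : ℂ ↦ log w) (1 / κ) κ := by simpa using hl 0
  have h27 : HasDerivAt (fun w : ℂ ↦ log (w - 27)) (1 / (κ - 27)) κ := by
    have := hl (-27); push_cast at this; simpa [sub_eq_add_neg] using this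
  have h64 : HasDerivAt (fun w : ℂ ↦ log (w + 64)) (1 / (κ + 64)) κ := by simpa using hl 64
  have h37 : HasDerivAt (fun w : ℂ ↦ log (w + 37)) (1 / (κ + 37)) κ := by simpa using hl 37
  have hs : HasDerivAt (fun w : ℂ ↦ ∑ u ∈ Icc (1 : ℕ) 10, (log (w + 25 + (u : ℂ)) - log (w + 12 - (u : ℂ))))
      (∑ u ∈ Icc (1 : ℕ) 10, (1 / (κ + 25 + (u : ℂ)) - 1 / (κ + 12 - (u : ℂ)))) κ := by
    refine HasDerivAt.fun_sum fun u _ ↦ ?_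
    have e1 : ∀ w : ℂ, w + 25 + (u : ℂ) = w + ((25 + u : ℝ) : ℂ) := fun w ↦ by push_cast; ring
    have e2 : ∀ w : ℂ, w + 12 - (u : ℂ) = w + ((12 - u : ℝ) : ℂ) := fun w ↦ by push_cast; ring
    simp_rw [e1, e2]
    exact (hl _).sub (hl _)
  have h := (((((h0.const_mul 3).sub (h27.const_mul 3)).add (h64.const_mul 3)).sub
    (h37.const_mul 3)).sub hs).add_const (2 * Real.pi * I)
  have hfun : dphase = fun w ↦ 3 * log w - 3 * log (w - 27) + 3 * log (w + 64) - 3 * log (w + 37) -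
      (∑ u ∈ Icc (1 : ℕ) 10, (log (w + 25 + (u : ℂ)) - log (w + 12 - (u : ℂ)))) + 2 * Real.pi * I := by
    funext w; rfl
  rw [hfun]
  refine h.congr_deriv ?_
  unfold ddphase
  ring

/-! ### The saddle polynomial -/

/-- The polynomial function `Q(κ) = κ³(κ+64)³∏_u(κ+12−u) − (κ−27)³(κ+37)³∏_u(κ+25+u)`
(`exp Φ' = 1 ⟺ Q = 0` off the poles). [cite: Zudilin2004, §8 Lemma 20] -/
def saddleQ (κ : ℂ) : ℂ :=
  κ ^ 3 * (κ + 64) ^ 3 * (∏ u ∈ Icc (1 : ℕ) 10, (κ + 12 - (u : ℂ))) -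
    (κ - 27) ^ 3 * (κ + 37) ^ 3 * ∏ u ∈ Icc (1 : ℕ) 10, (κ + 25 + (u : ℂ))

/-- A zero of `Q` in the upper half-plane with `‖Φ'‖ < 2π` is a zero of `Φ'`.
[cite: Zudilin2004, §8 Lemma 20] -/
theorem dphase_eq_zero_of_saddleQ {κ : ℂ} (hκ : 0 < κ.im) (hQ : saddleQ κ = 0)
    (hsmall : ‖dphase κ‖ < 2 * Real.pi) : dphase κ = 0 := by
  have hz0 : ∀ z : ℂ, z.im ≠ 0 → z ≠ 0 := fun z hz h ↦ hz (by simp [h])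
  have i0 : κ.im ≠ 0 := hκ.ne'
  have hden : (κ - 27) ^ 3 * (κ + 37) ^ 3 * ∏ u ∈ Icc (1 : ℕ) 10, (κ + 25 + (u : ℂ)) ≠ 0 := by
    refine mul_ne_zero (mul_ne_zero (pow_ne_zero 3 (hz0 _ ?_)) (pow_ne_zero 3 (hz0 _ ?_)))
      (prod_ne_zero_iff.2 fun u _ ↦ hz0 _ ?_) <;> simpa using i0
  have hexp : exp (dphase κ) = 1 := by
    rw [exp_dphase hκ, div_eq_one_iff_eq hden]
    unfold saddleQ at hQ
    exact sub_eq_zero.1 hQ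
  obtain ⟨n, hn⟩ := Complex.exp_eq_one_iff.1 hexp
  have hnorm : ‖dphase κ‖ = |(n : ℝ)| * (2 * Real.pi) := by
    rw [hn, norm_mul, norm_mul, Complex.norm_intCast, Complex.norm_I, mul_one, norm_mul,
      Complex.norm_real, Complex.norm_ofNat, Real.norm_eq_abs, abs_of_pos Real.pi_pos]
  rw [hnorm] at hsmall
  have hn0 : |(n : ℝ)| < 1 := by
    by_contra h
    have := mul_le_mul_of_nonneg_right (not_lt.mp h) (by positivity : (0 : ℝ) ≤ 2 * Real.pi)
    linarith
  have : n = 0 := Int.abs_lt_one_iff.mp (by exact_mod_cast hn0)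
  rw [hn, this]; simp

/-! ### Interval evaluators -/

namespace SaddleNum

/-- Working scale `2^100`. [folklore] -/
def S : ℕ := 2 ^ 100

/-- Series length for `log` and `arctan`. [folklore] -/
def K : ℕ := 110

/-- [folklore] -/
theorem S_pos : 0 < S := by unfold S; positivity

/-- The shifted box `B + a`. [folklore] -/
def shift (B : MC) (a : ℤ) : MC := B.add (MC.ofInt S a)

/-- [folklore] -/
theorem mem_shift {κ : ℂ} {B : MC} (hκ : MC.mem S κ B) (a : ℤ) :
    MC.mem S (κ + (a : ℂ)) (shift B a) := by
  have := MC.mem_add hκ (MC.mem_ofInt S a)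
  exact this

/-- Enclosure of `log (κ + a)` (`none` unless `im > 0` is certified). [folklore] -/
def clogBox (P : MI) (B : MC) (a : ℤ) : Option MC := MC.logUpper S K P (shift B a)

/-- [folklore] -/
theorem mem_clogBox {κ : ℂ} {B : MC} {P : MI} (hP : MI.mem S Real.pi P) (hκ : MC.mem S κ B)
    {a : ℤ} {Y : MC} (h : clogBox P B a = some Y) : MC.mem S (log (κ + (a : ℂ))) Y :=
  (MC.mem_logUpper S_pos hP h (mem_shift hκ a)).2

/-- Enclosure of `(κ + a) log (κ + a) − (κ + a)`. [folklore] -/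
def LBox (P : MI) (B : MC) (a : ℤ) : Option MC :=
  match clogBox P B a with
  | some L => some (((shift B a).mul S L).sub (shift B a))
  | none => none

/-- [folklore] -/
theorem mem_LBox {κ : ℂ} {B : MC} {P : MI} (hP : MI.mem S Real.pi P) (hκ : MC.mem S κ B)
    {a : ℤ} {Y : MC} (h : LBox P B a = some Y) :
    MC.mem S ((κ + (a : ℂ)) * log (κ + (a : ℂ)) - (κ + (a : ℂ))) Y := by
  unfold LBox at h
  split at h
  · rename_i L hL
    simp only [Option.some.injEq] at h
    subst h
    exact MC.mem_sub (MC.mem_mul S_pos (mem_shift hκ a) (mem_clogBox hP hκ hL)) (mem_shift hκ a)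
  · simp at h

/-- Enclosure of `blockInt κ a b`. [folklore] -/
def blockIntBox (P : MI) (B : MC) (a b : ℤ) : Option MC :=
  match LBox P B b, LBox P B a with
  | some X, some Y => some (X.sub Y)
  | _, _ => none

/-- [folklore] -/
theorem mem_blockIntBox {κ : ℂ} {B : MC} {P : MI} (hP : MI.mem S Real.pi P) (hκ : MC.mem S κ B)
    {a b : ℤ} {Y : MC} (h : blockIntBox P B a b = some Y) :
    MC.mem S (blockInt κ (a : ℝ) (b : ℝ)) Y := by
  unfold blockIntBox at h
  split at h
  · rename_i X Z hX hZ
    simp only [Option.some.injEq] at h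
    subst h
    have := MC.mem_sub (mem_LBox hP hκ hX) (mem_LBox hP hκ hZ)
    unfold blockInt
    push_cast at this ⊢
    exact this
  · simp at h

/-- The denominator blocks `Σ_{v=1}^{u} blockInt κ (12−v) (25+v)`, accumulated. [folklore] -/
def denomSum (P : MI) (B : MC) : ℕ → Option MC
  | 0 => some (MC.ofInt S 0)
  | u + 1 =>
    match denomSum P B u, blockIntBox P B (12 - (u + 1 : ℕ)) (25 + (u + 1 : ℕ)) with
    | some A, some X => some (A.add X)
    | _, _ => none

/-- [folklore] -/
theorem mem_denomSum {κ : ℂ} {B : MC} {P : MI} (hP : MI.mem S Real.pi P) (hκ : MC.mem S κ B) :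
    ∀ (u : ℕ) {Y : MC}, denomSum P B u = some Y →
      MC.mem S (∑ v ∈ Icc 1 u, blockInt κ (12 - (v : ℝ)) (25 + (v : ℝ))) Y
  | 0, Y, h => by
    simp only [denomSum, Option.some.injEq] at h
    subst h
    simpa using MC.mem_ofInt S 0
  | u + 1, Y, h => by
    simp only [denomSum] at h
    split at h
    · rename_i A X hA hX
      simp only [Option.some.injEq] at h
      subst h
      rw [Finset.sum_Icc_succ_top (by omega)]
      refine MC.mem_add (mem_denomSum hP hκ u hA) ?_
      have := mem_blockIntBox hP hκ hX
      push_cast at this ⊢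
      exact this
    · simp at h

/-- The constant `Σ_{v=1}^{u} ((13+2v) log(13+2v) − (13+2v))`, accumulated. [folklore] -/
def c1Sum : ℕ → Option MI
  | 0 => some (MI.ofInt S 0)
  | u + 1 =>
    match c1Sum u, MI.logNat2 S K (13 + 2 * (u + 1)) with
    | some A, some L => some (A.add ((L.mulInt (13 + 2 * (u + 1) : ℕ)).sub (MI.ofInt S (13 + 2 * (u + 1) : ℕ))))
    | _, _ => none

/-- [folklore] -/
theorem mem_c1Sum : ∀ (u : ℕ) {Y : MI}, c1Sum u = some Y →
    MI.mem S (∑ v ∈ Icc 1 u, ((13 + 2 * (v : ℝ)) * Real.log (13 + 2 * (v : ℝ)) - (13 + 2 * (v : ℝ)))) Y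
  | 0, Y, h => by
    simp only [c1Sum, Option.some.injEq] at h
    subst h
    simpa using MI.mem_ofInt S 0
  | u + 1, Y, h => by
    simp only [c1Sum] at h
    split at h
    · rename_i A L hA hL
      simp only [Option.some.injEq] at h
      subst h
      rw [Finset.sum_Icc_succ_top (by omega)]
      refine MI.mem_add (mem_c1Sum u hA) ?_
      have h1 := MI.mem_logNat2 S_pos hL
      have := MI.mem_sub (MI.mem_mulInt h1 ((13 + 2 * (u + 1) : ℕ) : ℤ)) (MI.mem_ofInt S ((13 + 2 * (u + 1) : ℕ) : ℤ))
      push_cast at this ⊢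
      convert this using 1
      ring
    · simp at h

/-- The constant `C₁ = Σ_u ((13+2u) log(13+2u) − (13+2u)) − 6 (27 log 27 − 27)` of `ψ`. [folklore] -/
def c1Box : Option MI :=
  match c1Sum 10, MI.logNat2 S K 27 with
  | some A, some L => some (A.sub (((L.mulInt 27).sub (MI.ofInt S 27)).mulInt 6))
  | _, _ => none

/-- [folklore] -/
theorem mem_c1Box {Y : MI} (h : c1Box = some Y) :
    MI.mem S ((∑ u ∈ Icc (1 : ℕ) 10, ((13 + 2 * (u : ℝ)) * Real.log (13 + 2 * (u : ℝ)) -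
      (13 + 2 * (u : ℝ)))) - 6 * (27 * Real.log 27 - 27)) Y := by
  unfold c1Box at h
  split at h
  · rename_i A L hA hL
    simp only [Option.some.injEq] at h
    subst h
    have h1 := MI.mem_logNat2 S_pos hL
    have := MI.mem_sub (mem_c1Sum 10 hA)
      (MI.mem_mulInt (MI.mem_sub (MI.mem_mulInt h1 27) (MI.mem_ofInt S 27)) 6)
    push_cast at this ⊢
    convert this using 1
    ring
  · simp at h

/-- Enclosure of `ψ(κ)`. [cite: Zudilin2004, §8 Lemma 20] -/
def psiRBox (P : MI) (B : MC) : Option MC :=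
  match blockIntBox P B (-27) 0, blockIntBox P B 37 64, denomSum P B 10, c1Box with
  | some X, some Y, some D, some C =>
    some ((((X.mulInt 3).add (Y.mulInt 3)).sub D).add (MC.ofMI S C))
  | _, _, _, _ => none

/-- [folklore] -/
theorem mem_psiRBox {κ : ℂ} {B : MC} {P : MI} (hP : MI.mem S Real.pi P) (hκ : MC.mem S κ B)
    {Y : MC} (h : psiRBox P B = some Y) : MC.mem S (psiR κ) Y := by
  unfold psiRBox at h
  split at h
  · rename_i X Z D C hX hZ hD hC
    simp only [Option.some.injEq] at h
    subst h
    have h1 := mem_blockIntBox hP hκ hX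
    have h2 := mem_blockIntBox hP hκ hZ
    have h3 := mem_denomSum hP hκ 10 hD
    have h4 := MC.mem_ofMI (S := S) (mem_c1Box hC)
    have := MC.mem_add (MC.mem_sub (MC.mem_add (MC.mem_mulInt h1 3) (MC.mem_mulInt h2 3)) h3) h4
    unfold psiR
    push_cast at this ⊢
    convert this using 2
    ring
  · simp at h

/-- Enclosure of `Φ(κ) = ψ(κ) + 2πiκ`. [cite: Zudilin2004, §8 Lemma 20] -/
def phaseBox (P : MI) (B : MC) : Option MC :=
  match psiRBox P B with
  | some X => some (X.add (((B.mulMI S P).mulInt 2).mulI))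
  | none => none

/-- [folklore] -/
theorem mem_phaseBox {κ : ℂ} {B : MC} {P : MI} (hP : MI.mem S Real.pi P) (hκ : MC.mem S κ B)
    {Y : MC} (h : phaseBox P B = some Y) : MC.mem S (phase κ) Y := by
  unfold phaseBox at h
  split at h
  · rename_i X hX
    simp only [Option.some.injEq] at h
    subst h
    have h1 := mem_psiRBox hP hκ hX
    have h2 := MC.mem_mulI (MC.mem_mulInt (MC.mem_mulMI S_pos hκ hP) 2)
    have := MC.mem_add h1 h2
    unfold phase
    convert this using 2
    push_cast
    ring
  · simp at h

/-- The logarithmic denominator sum `Σ_{v=1}^{u} (log(κ+25+v) − log(κ+12−v))`. [folklore] -/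
def dlogSum (P : MI) (B : MC) : ℕ → Option MC
  | 0 => some (MC.ofInt S 0)
  | u + 1 =>
    match dlogSum P B u, clogBox P B (25 + (u + 1 : ℕ)), clogBox P B (12 - (u + 1 : ℕ)) with
    | some A, some X, some Y => some (A.add (X.sub Y))
    | _, _, _ => none

/-- [folklore] -/
theorem mem_dlogSum {κ : ℂ} {B : MC} {P : MI} (hP : MI.mem S Real.pi P) (hκ : MC.mem S κ B) :
    ∀ (u : ℕ) {Y : MC}, dlogSum P B u = some Y →
      MC.mem S (∑ v ∈ Icc 1 u, (log (κ + 25 + (v : ℂ)) - log (κ + 12 - (v : ℂ)))) Y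
  | 0, Y, h => by
    simp only [dlogSum, Option.some.injEq] at h
    subst h
    simpa using MC.mem_ofInt S 0
  | u + 1, Y, h => by
    simp only [dlogSum] at h
    split at h
    · rename_i A X Z hA hX hZ
      simp only [Option.some.injEq] at h
      subst h
      rw [Finset.sum_Icc_succ_top (by omega)]
      refine MC.mem_add (mem_dlogSum hP hκ u hA) ?_
      have h1 := mem_clogBox hP hκ hX
      have h2 := mem_clogBox hP hκ hZ
      have := MC.mem_sub h1 h2
      push_cast at this ⊢
      convert this using 2 <;> ring_nf
    · simp at h

/-- Enclosure of `Φ'(κ)`. [cite: Zudilin2004, §8 Lemma 20] -/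
def dphaseBox (P : MI) (B : MC) : Option MC :=
  match clogBox P B 0, clogBox P B (-27), clogBox P B 64, clogBox P B 37, dlogSum P B 10 with
  | some L0, some L27, some L64, some L37, some D =>
    some ((((((L0.sub L27).add L64).sub L37).mulInt 3).sub D).add (MC.mk' (MI.ofInt S 0) (P.mulInt 2)))
  | _, _, _, _, _ => none

/-- [folklore] -/
theorem mem_dphaseBox {κ : ℂ} {B : MC} {P : MI} (hP : MI.mem S Real.pi P) (hκ : MC.mem S κ B)
    {Y : MC} (h : dphaseBox P B = some Y) : MC.mem S (dphase κ) Y := by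
  unfold dphaseBox at h
  split at h
  · rename_i L0 L27 L64 L37 D h0 h27 h64 h37 hD
    simp only [Option.some.injEq] at h
    subst h
    have i0 := mem_clogBox hP hκ h0
    have i27 := mem_clogBox hP hκ h27
    have i64 := mem_clogBox hP hκ h64
    have i37 := mem_clogBox hP hκ h37
    have iD := mem_dlogSum hP hκ 10 hD
    have ipi : MC.mem S (2 * Real.pi * I) (MC.mk' (MI.ofInt S 0) (P.mulInt 2)) := by
      refine MC.mem_mk' ?_ ?_
      · simpa using MI.mem_ofInt S 0
      · have := MI.mem_mulInt hP 2; simpa [mul_comm] using this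
    have := MC.mem_add (MC.mem_sub (MC.mem_mulInt
      (MC.mem_sub (MC.mem_add (MC.mem_sub i0 i27) i64) i37) 3) iD) ipi
    unfold dphase
    push_cast at this ⊢
    convert this using 2
    simp only [add_zero, ← sub_eq_add_neg]
    ring_nf
  · simp at h

/-- The rational denominator sum `Σ_{v=1}^{u} (1/(κ+25+v) − 1/(κ+12−v))`. [folklore] -/
def ddSum (B : MC) : ℕ → Option MC
  | 0 => some (MC.ofInt S 0)
  | u + 1 =>
    match ddSum B u, MC.divBox S (MC.ofInt S 1) (shift B (25 + (u + 1 : ℕ))),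
      MC.divBox S (MC.ofInt S 1) (shift B (12 - (u + 1 : ℕ))) with
    | some A, some X, some Y => some (A.add (X.sub Y))
    | _, _, _ => none

/-- [folklore] -/
theorem mem_ddSum {κ : ℂ} {B : MC} (hκ : MC.mem S κ B) :
    ∀ (u : ℕ) {Y : MC}, ddSum B u = some Y →
      MC.mem S (∑ v ∈ Icc 1 u, (1 / (κ + 25 + (v : ℂ)) - 1 / (κ + 12 - (v : ℂ)))) Y
  | 0, Y, h => by
    simp only [ddSum, Option.some.injEq] at h
    subst h
    simpa using MC.mem_ofInt S 0
  | u + 1, Y, h => by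
    simp only [ddSum] at h
    split at h
    · rename_i A X Z hA hX hZ
      simp only [Option.some.injEq] at h
      subst h
      rw [Finset.sum_Icc_succ_top (by omega)]
      refine MC.mem_add (mem_ddSum hκ u hA) ?_
      have h1 := MC.mem_divBox S_pos hX (MC.mem_ofInt S 1) (mem_shift hκ _)
      have h2 := MC.mem_divBox S_pos hZ (MC.mem_ofInt S 1) (mem_shift hκ _)
      have := MC.mem_sub h1 h2
      push_cast at this ⊢
      convert this using 2 <;> ring_nf
    · simp at h

/-- Enclosure of `Φ''(κ)`. [cite: Zudilin2004, §8 Lemma 20] -/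
def ddphaseBox (B : MC) : Option MC :=
  match MC.divBox S (MC.ofInt S 3) (shift B 0), MC.divBox S (MC.ofInt S 3) (shift B (-27)),
    MC.divBox S (MC.ofInt S 3) (shift B 64), MC.divBox S (MC.ofInt S 3) (shift B 37), ddSum B 10 with
  | some L0, some L27, some L64, some L37, some D => some ((((L0.sub L27).add L64).sub L37).sub D)
  | _, _, _, _, _ => none

/-- [folklore] -/
theorem mem_ddphaseBox {κ : ℂ} {B : MC} (hκ : MC.mem S κ B) {Y : MC} (h : ddphaseBox B = some Y) :
    MC.mem S (ddphase κ) Y := by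
  unfold ddphaseBox at h
  split at h
  · rename_i L0 L27 L64 L37 D h0 h27 h64 h37 hD
    simp only [Option.some.injEq] at h
    subst h
    have i0 := MC.mem_divBox S_pos h0 (MC.mem_ofInt S 3) (mem_shift hκ _)
    have i27 := MC.mem_divBox S_pos h27 (MC.mem_ofInt S 3) (mem_shift hκ _)
    have i64 := MC.mem_divBox S_pos h64 (MC.mem_ofInt S 3) (mem_shift hκ _)
    have i37 := MC.mem_divBox S_pos h37 (MC.mem_ofInt S 3) (mem_shift hκ _)
    have iD := mem_ddSum hκ 10 hD
    have := MC.mem_sub (MC.mem_sub (MC.mem_add (MC.mem_sub i0 i27) i64) i37) iD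
    unfold ddphase
    push_cast at this ⊢
    convert this using 2
    simp only [add_zero, ← sub_eq_add_neg]
  · simp at h

/-! ### The saddle polynomial, at a finer scale -/

/-- `∏_{v=1}^{u} (κ + 12 − v)` at scale `T`, accumulated. [folklore] -/
def qProdA (T : ℕ) (B : MC) : ℕ → MC
  | 0 => MC.ofInt T 1
  | u + 1 => (qProdA T B u).mul T (B.add (MC.ofInt T (12 - (u + 1 : ℕ))))

/-- `∏_{v=1}^{u} (κ + 25 + v)` at scale `T`, accumulated. [folklore] -/
def qProdB (T : ℕ) (B : MC) : ℕ → MC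
  | 0 => MC.ofInt T 1
  | u + 1 => (qProdB T B u).mul T (B.add (MC.ofInt T (25 + (u + 1 : ℕ))))

/-- [folklore] -/
theorem mem_qProdA {T : ℕ} (hT : 0 < T) {κ : ℂ} {B : MC} (hκ : MC.mem T κ B) :
    ∀ u : ℕ, MC.mem T (∏ v ∈ Icc 1 u, (κ + 12 - (v : ℂ))) (qProdA T B u)
  | 0 => by simpa [qProdA] using MC.mem_ofInt T 1
  | u + 1 => by
    rw [Finset.prod_Icc_succ_top (by omega), qProdA]
    refine MC.mem_mul hT (mem_qProdA hT hκ u) ?_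
    have e : κ + 12 - ((u + 1 : ℕ) : ℂ) = κ + (((12 - (u + 1 : ℕ) : ℤ)) : ℂ) := by push_cast; ring
    rw [e]
    exact MC.mem_add hκ (MC.mem_ofInt T (12 - (u + 1 : ℕ)))

/-- [folklore] -/
theorem mem_qProdB {T : ℕ} (hT : 0 < T) {κ : ℂ} {B : MC} (hκ : MC.mem T κ B) :
    ∀ u : ℕ, MC.mem T (∏ v ∈ Icc 1 u, (κ + 25 + (v : ℂ))) (qProdB T B u)
  | 0 => by simpa [qProdB] using MC.mem_ofInt T 1
  | u + 1 => by
    rw [Finset.prod_Icc_succ_top (by omega), qProdB]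
    refine MC.mem_mul hT (mem_qProdB hT hκ u) ?_
    have e : κ + 25 + ((u + 1 : ℕ) : ℂ) = κ + (((25 + (u + 1 : ℕ) : ℤ)) : ℂ) := by push_cast; ring
    rw [e]
    exact MC.mem_add hκ (MC.mem_ofInt T (25 + (u + 1 : ℕ)))

/-- Enclosure of `Q(κ)` at scale `T`. [cite: Zudilin2004, §8 Lemma 20] -/
def saddleQBox (T : ℕ) (B : MC) : MC :=
  let c0 := (B.sqr T).mul T B
  let c64 := ((B.add (MC.ofInt T 64)).sqr T).mul T (B.add (MC.ofInt T 64))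
  let c27 := ((B.sub (MC.ofInt T 27)).sqr T).mul T (B.sub (MC.ofInt T 27))
  let c37 := ((B.add (MC.ofInt T 37)).sqr T).mul T (B.add (MC.ofInt T 37))
  (((c0.mul T c64).mul T (qProdA T B 10))).sub ((c27.mul T c37).mul T (qProdB T B 10))

/-- [folklore] -/
theorem mem_saddleQBox {T : ℕ} (hT : 0 < T) {κ : ℂ} {B : MC} (hκ : MC.mem T κ B) :
    MC.mem T (saddleQ κ) (saddleQBox T B) := by
  have cube : ∀ {z : ℂ} {A : MC}, MC.mem T z A → MC.mem T (z ^ 3) ((A.sqr T).mul T A) :=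
    fun hz ↦ by rw [pow_succ]; exact MC.mem_mul hT (MC.mem_sqr hT hz) hz
  have h0 := cube hκ
  have h64 := cube (MC.mem_add hκ (MC.mem_ofInt T 64))
  have h27 := cube (MC.mem_sub hκ (MC.mem_ofInt T 27))
  have h37 := cube (MC.mem_add hκ (MC.mem_ofInt T 37))
  have := MC.mem_sub (MC.mem_mul hT (MC.mem_mul hT h0 h64) (mem_qProdA hT hκ 10))
    (MC.mem_mul hT (MC.mem_mul hT h27 h37) (mem_qProdB hT hκ 10))
  unfold saddleQ
  push_cast at this
  exact this

/-! ### The data of the certificates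

The approximate saddle point `κ̃ = (pRe + i pIm)/2^100` (60 digits of
`κ₀ = 23.47900541834584313820… + 3.32820690552685008708… i` rounded to scale `2^100`; obtained
by Newton's method for `Q`), the box `boxB = κ̃ + [−2^{−60}, 2^{−60}]²`, vertical boxes
`lineBox lo hi = re boxB × [lo, hi]/2^100` on the line `re κ = re κ̃ ± 2^{−60}`, an enclosure
`sBox ⊇ saddleBox`, and the Boolean scan `checkConcave` of `re Φ'' > 0` up the line
(boxes of height `2^{e-100}`). -/

/-- Scaled real part of `κ̃` (`re κ̃ = pRe / 2^100`). [cite: Zudilin2004, §8 proof of Thm. 3] -/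
def pRe : ℤ := 29763175311327958416018371830637

/-- Scaled imaginary part of `κ̃` (`im κ̃ = pIm / 2^100`). [cite: Zudilin2004, §8 proof of Thm. 3] -/
def pIm : ℤ := 4219003481474849499105701662186

/-- The approximate saddle point `κ̃ = 23.4790054183458431382… + 3.3282069055268500870… i`.
[cite: Zudilin2004, §8 proof of Thm. 3] -/
def kApprox : ℂ := ⟨(pRe : ℝ) / 2 ^ 100, (pIm : ℝ) / 2 ^ 100⟩

/-- The box `κ̃ + [−2^{−60}, 2^{−60}]²` at scale `2^100`. [folklore] -/
def boxB : MC := ⟨⟨pRe - 2 ^ 40, pRe + 2 ^ 40⟩, ⟨pIm - 2 ^ 40, pIm + 2 ^ 40⟩⟩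

/-- The vertical box `(re κ̃ ± 2^{−60}) + i [lo, hi]/2^100`. [folklore] -/
def lineBox (lo hi : ℤ) : MC := ⟨⟨pRe - 2 ^ 40, pRe + 2 ^ 40⟩, ⟨lo, hi⟩⟩

/-- An enclosure of `saddleBox` (`|re κ − 23.479| ≤ 1/100`, `|im κ − 3.328| ≤ 1/100`). [folklore] -/
def sBox : MC :=
  ⟨⟨(MI.ofFrac S 23469 1000).lo, (MI.ofFrac S 23489 1000).hi⟩,
    ⟨(MI.ofFrac S 3318 1000).lo, (MI.ofFrac S 3338 1000).hi⟩⟩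

/-- The enclosure of `π` used throughout (Machin, 80 terms). [folklore] -/
def piBox : Option MI := MI.pi S 80

/-- [folklore] -/
theorem S_eq : (S : ℝ) = 2 ^ 100 := by unfold S; norm_num

/-- [folklore] -/
theorem kApprox_re : kApprox.re = (pRe : ℝ) / 2 ^ 100 := rfl

/-- [folklore] -/
theorem kApprox_im : kApprox.im = (pIm : ℝ) / 2 ^ 100 := rfl

/-- Points within `2^{−60}` of `κ̃` (in each coordinate) lie in `boxB`. [folklore] -/
theorem mem_boxB {κ : ℂ} (hre : |κ.re - kApprox.re| ≤ (2 : ℝ) ^ (-60 : ℤ))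
    (him : |κ.im - kApprox.im| ≤ (2 : ℝ) ^ (-60 : ℤ)) : MC.mem S κ boxB := by
  rw [kApprox_re] at hre
  rw [kApprox_im] at him
  rw [abs_le] at hre him
  have e60 : (2 : ℝ) ^ (-60 : ℤ) * 2 ^ 100 = 2 ^ 40 := by
    rw [← zpow_natCast, ← zpow_add₀ (by norm_num)]; norm_num
  refine ⟨⟨?_, ?_⟩, ⟨?_, ?_⟩⟩ <;> simp only [boxB, S_eq] <;> push_cast <;> nlinarith [e60]

/-- [folklore] -/
theorem mem_boxB_of_norm {κ : ℂ} (h : ‖κ - kApprox‖ ≤ (2 : ℝ) ^ (-60 : ℤ)) : MC.mem S κ boxB :=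
  mem_boxB (by simpa using (abs_re_le_norm (κ - kApprox)).trans h)
    (by simpa using (abs_im_le_norm (κ - kApprox)).trans h)

/-- Points of the line `|re κ − re κ̃| ≤ 2^{−60}` with `lo ≤ 2^100 im κ ≤ hi` lie in `lineBox lo hi`.
[folklore] -/
theorem mem_lineBox {κ : ℂ} (hre : |κ.re - kApprox.re| ≤ (2 : ℝ) ^ (-60 : ℤ)) {lo hi : ℤ}
    (hlo : (lo : ℝ) ≤ κ.im * 2 ^ 100) (hhi : κ.im * 2 ^ 100 ≤ hi) : MC.mem S κ (lineBox lo hi) := by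
  rw [kApprox_re, abs_le] at hre
  have e60 : (2 : ℝ) ^ (-60 : ℤ) * 2 ^ 100 = 2 ^ 40 := by
    rw [← zpow_natCast, ← zpow_add₀ (by norm_num)]; norm_num
  refine ⟨⟨?_, ?_⟩, ⟨?_, ?_⟩⟩ <;> simp only [lineBox, S_eq] <;> push_cast <;> nlinarith [e60]

/-- `saddleBox ⊆ sBox`. [folklore] -/
theorem mem_sBox {κ : ℂ} (hκ : κ ∈ saddleBox) : MC.mem S κ sBox := by
  obtain ⟨hre, him⟩ := hκ
  rw [abs_le] at hre him
  have m1 := MI.mem_ofFrac S 23469 (q := 1000) (by norm_num)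
  have m2 := MI.mem_ofFrac S 23489 (q := 1000) (by norm_num)
  have m3 := MI.mem_ofFrac S 3318 (q := 1000) (by norm_num)
  have m4 := MI.mem_ofFrac S 3338 (q := 1000) (by norm_num)
  have hS : (0 : ℝ) < S := by rw [S_eq]; norm_num
  refine ⟨⟨?_, ?_⟩, ⟨?_, ?_⟩⟩ <;> simp only [sBox]
  · refine m1.1.trans ?_; push_cast; nlinarith
  · refine le_trans ?_ m2.2; push_cast; nlinarith
  · refine m3.1.trans ?_; push_cast; nlinarith
  · refine le_trans ?_ m4.2; push_cast; nlinarith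

/-- The scan: `re ddphaseBox > 0` on the `m` boxes `lineBox (k 2^e) ((k+1) 2^e)`,
`k₀ ≤ k < k₀ + m` (heights `[k, k+1] · 2^{e−100}`). [folklore] -/
def checkConcave (e k₀ : ℕ) : ℕ → Bool
  | 0 => true
  | m + 1 =>
    checkConcave e k₀ m &&
      match ddphaseBox (lineBox (((k₀ + m : ℕ) : ℤ) * 2 ^ e) ((((k₀ + m : ℕ) : ℤ) + 1) * 2 ^ e)) with
      | some D => decide (0 < D.re.lo)
      | none => false

/-- Soundness of the scan: `re Φ''(κ) > 0` for `|re κ − re κ̃| ≤ 2^{−60}` and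
`k₀ 2^e ≤ 2^100 im κ ≤ (k₀ + m) 2^e` (`m ≥ 1`). [cite: Zudilin2004, §8 Lemma 20] -/
theorem re_ddphase_pos_of_checkConcave {e k₀ m : ℕ} (h : checkConcave e k₀ m = true) (hm : 0 < m)
    {κ : ℂ} (hre : |κ.re - kApprox.re| ≤ (2 : ℝ) ^ (-60 : ℤ)) (h0 : (k₀ : ℝ) * 2 ^ e ≤ κ.im * 2 ^ 100)
    (h1 : κ.im * 2 ^ 100 ≤ ((k₀ : ℝ) + m) * 2 ^ e) : 0 < (ddphase κ).re := by
  induction m with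
  | zero => exact absurd hm (lt_irrefl 0)
  | succ m ih =>
    rw [checkConcave, Bool.and_eq_true] at h
    obtain ⟨hrec, hbox⟩ := h
    by_cases hcase : m ≠ 0 ∧ κ.im * 2 ^ 100 ≤ ((k₀ : ℝ) + m) * 2 ^ e
    · exact ih hrec (Nat.pos_of_ne_zero hcase.1) hcase.2
    · have hlo : ((k₀ : ℝ) + m) * 2 ^ e ≤ κ.im * 2 ^ 100 := by
        rw [not_and_or] at hcase
        rcases hcase with hm0 | hlt
        · have hm0' : m = 0 := by simpa using hm0
          rw [hm0']; simpa using h0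
        · exact (not_le.mp hlt).le
      cases hq : ddphaseBox (lineBox (((k₀ + m : ℕ) : ℤ) * 2 ^ e) ((((k₀ + m : ℕ) : ℤ) + 1) * 2 ^ e)) with
      | none => simp only [hq] at hbox; exact absurd hbox Bool.false_ne_true
      | some D =>
        simp only [hq] at hbox
        have hpos : 0 < D.re.lo := of_decide_eq_true hbox
        have hmem : MC.mem S κ (lineBox (((k₀ + m : ℕ) : ℤ) * 2 ^ e) ((((k₀ + m : ℕ) : ℤ) + 1) * 2 ^ e)) := by
          refine mem_lineBox hre ?_ ?_
          · push_cast; exact hlo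
          · push_cast
            have : κ.im * 2 ^ 100 ≤ ((k₀ : ℝ) + (m + 1)) * 2 ^ e := by push_cast at h1; exact h1
            linarith
        exact MI.pos_of_lo_pos (mem_ddphaseBox hmem hq).1 hpos

end SaddleNum

end Zudilin2004

end Literature.NumberTheory.Transcendental
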